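import Literature.Probability.Percolation.MedialPolygon
import HarnessLib

/-!
# Lattice points and face centres stay away from interface loops

Topic: Probability / Percolation (groundwork for the loop representation of critical bond
percolation on `ℤ²`, Duminil-Copin–Kozlowski–Krachun–Manolescu–Oulamara, arXiv:2012.11672,
§1.1; Grimmett, *Percolation* (1999), §11.2).

At mesh `1` the trace of a percolation interface is a union of corner cuts
(`exists_cornerCut_of_mem_range_loopCurve`, `MedialPolygon.lean`), and a corner cut of the
face `f` lies on the `ℓ¹`-sphere of radius `1/2` about the centre of `f`
(`l1DistC_eq_of_mem_cornerCut`, `MedialGrid.lean`). Since lattice points are at `ℓ¹`-distance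
`≥ 1` from every face centre and distinct face centres are at `ℓ¹`-distance `≥ 1` from each
other, every lattice point and every face centre is at `ℓ¹`-distance `≥ 1/2`, hence at
Euclidean distance `≥ √2/4`, from every corner cut (`sqrt_two_div_four_le_dist_meshPoint`,
`sqrt_two_div_four_le_dist_faceCenter`) and therefore from the trace of every interface loop
(`IsInterfaceLoop.le_infDist_meshPoint`, `IsInterfaceLoop.le_infDist_faceCenter`). These are
the "fat points" at which winding numbers of interface loops are evaluated.

## References
* H. Duminil-Copin, K. K. Kozlowski, D. Krachun, I. Manolescu, M. Oulamara, *Rotational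
  invariance in critical planar lattice models*, arXiv:2012.11672, §1.1 [arXiv201211672].
* G. Grimmett, *Percolation*, 2nd ed., Springer (1999), §11.2 [Grimmett1999].
-/

noncomputable section

open Complex Metric

namespace Literature.Probability.Percolation

open LatticeModels

/-- `ℓ¹` distance is symmetric. [folklore] -/
theorem l1DistC_comm (x y : ℂ) : l1DistC x y = l1DistC y x := by
  unfold l1DistC; rw [abs_sub_comm x.re, abs_sub_comm x.im]

/-- Triangle inequality for the `ℓ¹` distance. [folklore] -/
theorem l1DistC_triangle (x y z : ℂ) : l1DistC x z ≤ l1DistC x y + l1DistC y z := by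
  unfold l1DistC
  have h1 := abs_sub_le x.re y.re z.re
  have h2 := abs_sub_le x.im y.im z.im
  linarith

/-- `ℓ¹ ≤ √2 · ℓ²` in the plane. [folklore] -/
theorem l1DistC_le_sqrt_two_mul_dist (x y : ℂ) : l1DistC x y ≤ Real.sqrt 2 * dist x y := by
  unfold l1DistC
  rw [Complex.dist_eq, Complex.norm_eq_sqrt_sq_add_sq, Complex.sub_re, Complex.sub_im,
    ← Real.sqrt_mul zero_le_two]
  apply Real.le_sqrt_of_sq_le
  set a := x.re - y.re
  set b := x.im - y.im
  have ha : |a| ^ 2 = a ^ 2 := sq_abs a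
  have hb : |b| ^ 2 = b ^ 2 := sq_abs b
  nlinarith [sq_nonneg (|a| - |b|), abs_nonneg a, abs_nonneg b]

/-- A half-integer is at distance `≥ 1/2` from every integer. [folklore] -/
theorem half_le_abs_int_sub_half (m n : ℤ) : (1 / 2 : ℝ) ≤ |(m : ℝ) - (n + 1 / 2)| := by
  rcases le_or_gt m n with h | h
  · have : (m : ℝ) ≤ n := by exact_mod_cast h
    rw [abs_of_neg (by linarith)]; linarith
  · have : (n : ℝ) + 1 ≤ m := by exact_mod_cast h
    rw [abs_of_pos (by linarith)]; linarith

/-- A lattice point is at `ℓ¹`-distance `≥ 1` from every face centre. [folklore] -/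
theorem one_le_l1DistC_meshPoint_faceCenter (w f : Site 2) :
    1 ≤ l1DistC (meshPoint 1 w) (faceCenter f) := by
  unfold l1DistC
  have h0 := half_le_abs_int_sub_half (w 0) (f 0)
  have h1 := half_le_abs_int_sub_half (w 1) (f 1)
  simp only [meshPoint_re, meshPoint_im, one_mul, faceCenter_re, faceCenter_im]
  linarith

/-- Distinct face centres are at `ℓ¹`-distance `≥ 1`. [folklore] -/
theorem one_le_l1DistC_faceCenter_faceCenter {g f : Site 2} (h : g ≠ f) :
    1 ≤ l1DistC (faceCenter g) (faceCenter f) := by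
  unfold l1DistC
  simp only [faceCenter_re, faceCenter_im, add_sub_add_right_eq_sub]
  have key : g 0 ≠ f 0 ∨ g 1 ≠ f 1 := by
    by_contra hc
    simp only [not_or, not_not] at hc
    exact h (funext fun i ↦ by fin_cases i <;> simp [hc.1, hc.2])
  rcases key with h0 | h0
  · have : (1 : ℝ) ≤ |(g 0 : ℝ) - f 0| := by
      rw [← Int.cast_sub, ← Int.cast_abs]; exact_mod_cast Int.one_le_abs (sub_ne_zero.2 h0)
    linarith [abs_nonneg ((g 1 : ℝ) - f 1)]
  · have : (1 : ℝ) ≤ |(g 1 : ℝ) - f 1| := by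
      rw [← Int.cast_sub, ← Int.cast_abs]; exact_mod_cast Int.one_le_abs (sub_ne_zero.2 h0)
    linarith [abs_nonneg ((g 0 : ℝ) - f 0)]

/-- A point of a corner cut is at `ℓ¹`-distance `≥ 1/2` from every lattice point. [folklore] -/
theorem half_le_l1DistC_meshPoint_of_mem_cornerCut {v f : Site 2} (hv : IsCorner v f) {x : ℂ}
    (hx : x ∈ cornerCut v f) (w : Site 2) : 1 / 2 ≤ l1DistC x (meshPoint 1 w) := by
  have h1 := l1DistC_eq_of_mem_cornerCut hv hx
  have h2 := one_le_l1DistC_meshPoint_faceCenter w f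
  have h3 := l1DistC_triangle (meshPoint 1 w) x (faceCenter f)
  rw [l1DistC_comm (meshPoint 1 w) x] at h3
  linarith

/-- A point of a corner cut is at `ℓ¹`-distance `≥ 1/2` from every face centre. [folklore] -/
theorem half_le_l1DistC_faceCenter_of_mem_cornerCut {v f : Site 2} (hv : IsCorner v f) {x : ℂ}
    (hx : x ∈ cornerCut v f) (g : Site 2) : 1 / 2 ≤ l1DistC x (faceCenter g) := by
  have h1 := l1DistC_eq_of_mem_cornerCut hv hx
  by_cases hg : g = f
  · rw [hg, h1]
  · have h2 := one_le_l1DistC_faceCenter_faceCenter hg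
    have h3 := l1DistC_triangle (faceCenter g) x (faceCenter f)
    rw [l1DistC_comm (faceCenter g) x] at h3
    linarith

/-- `√2 / 4 = (1/2) / √2`: an `ℓ¹`-distance `≥ 1/2` forces Euclidean distance `≥ √2/4`.
[folklore] -/
theorem sqrt_two_div_four_le_dist_of_le_l1DistC {x y : ℂ} (h : 1 / 2 ≤ l1DistC x y) :
    Real.sqrt 2 / 4 ≤ dist x y := by
  have h2 := l1DistC_le_sqrt_two_mul_dist x y
  have hs : Real.sqrt 2 * Real.sqrt 2 = 2 := Real.mul_self_sqrt zero_le_two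
  have hpos : 0 < Real.sqrt 2 := Real.sqrt_pos.2 zero_lt_two
  nlinarith

/-- **Lattice points are `√2/4`-far from corner cuts.** [folklore] -/
theorem sqrt_two_div_four_le_dist_meshPoint {v f : Site 2} (hv : IsCorner v f) {x : ℂ}
    (hx : x ∈ cornerCut v f) (w : Site 2) : Real.sqrt 2 / 4 ≤ dist x (meshPoint 1 w) :=
  sqrt_two_div_four_le_dist_of_le_l1DistC (half_le_l1DistC_meshPoint_of_mem_cornerCut hv hx w)

/-- **Face centres are `√2/4`-far from corner cuts.** [folklore] -/
theorem sqrt_two_div_four_le_dist_faceCenter {v f : Site 2} (hv : IsCorner v f) {x : ℂ}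
    (hx : x ∈ cornerCut v f) (g : Site 2) : Real.sqrt 2 / 4 ≤ dist x (faceCenter g) :=
  sqrt_two_div_four_le_dist_of_le_l1DistC (half_le_l1DistC_faceCenter_of_mem_cornerCut hv hx g)

/-- An interface loop has at least two medial vertices (a dart joins distinct medial vertices).
(DKKMO 2020, §1.1.) [cite: arXiv201211672, §1.1] -/
theorem IsInterfaceLoop.two_le_length {ω : BondConfig (Site 2)} {γ : List MedialVertex}
    (h : IsInterfaceLoop ω γ) : 2 ≤ γ.length := by
  have h0 := h.length_pos
  by_contra hlt
  have h1 : γ.length = 1 := by omega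
  have hd := h.isMedialDart 0 h0
  have hidx : (0 + 1) % γ.length = 0 := by rw [h1]
  simp only [hidx] at hd
  exact hd.ne rfl

/-- **Lattice points are `√2/4`-far from interface loops** (mesh `1`, unrotated): for every
lattice point `w` and every point `x` of the trace of an interface loop, `√2/4 ≤ dist x w`.
(DKKMO 2020, §1.1; Grimmett 1999, §11.2: interfaces run on the medial lattice, through the
midpoints of the edges.) [cite: arXiv201211672, §1.1] -/
theorem IsInterfaceLoop.sqrt_two_div_four_le_dist_meshPoint {ω : BondConfig (Site 2)}
    {γ : List MedialVertex} (h : IsInterfaceLoop ω γ) {x : ℂ} (hx : x ∈ (loopCurve 1 0 γ).range)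
    (w : Site 2) : Real.sqrt 2 / 4 ≤ dist x (meshPoint 1 w) := by
  obtain ⟨-, -, v, f, hv, -, -, hxc⟩ := exists_cornerCut_of_mem_range_loopCurve h hx
  exact Literature.Probability.Percolation.sqrt_two_div_four_le_dist_meshPoint hv hxc w

/-- **Face centres are `√2/4`-far from interface loops** (mesh `1`, unrotated).
(DKKMO 2020, §1.1; Grimmett 1999, §11.2.) [cite: arXiv201211672, §1.1] -/
theorem IsInterfaceLoop.sqrt_two_div_four_le_dist_faceCenter {ω : BondConfig (Site 2)}
    {γ : List MedialVertex} (h : IsInterfaceLoop ω γ) {x : ℂ} (hx : x ∈ (loopCurve 1 0 γ).range)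
    (g : Site 2) : Real.sqrt 2 / 4 ≤ dist x (faceCenter g) := by
  obtain ⟨-, -, v, f, hv, -, -, hxc⟩ := exists_cornerCut_of_mem_range_loopCurve h hx
  exact Literature.Probability.Percolation.sqrt_two_div_four_le_dist_faceCenter hv hxc g

/-- The distance from a lattice point to the trace of an interface loop is at least `√2/4`
(mesh `1`, unrotated). (DKKMO 2020, §1.1.) [cite: arXiv201211672, §1.1] -/
theorem IsInterfaceLoop.le_infDist_meshPoint {ω : BondConfig (Site 2)} {γ : List MedialVertex}
    (h : IsInterfaceLoop ω γ) (w : Site 2) :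
    Real.sqrt 2 / 4 ≤ Metric.infDist (meshPoint 1 w) (loopCurve 1 0 γ).range := by
  refine (Metric.le_infDist (RandomPlanarGeometry.CurveClass.range_nonempty _)).2 fun x hx ↦ ?_
  rw [dist_comm]
  exact h.sqrt_two_div_four_le_dist_meshPoint hx w

/-- The distance from a face centre to the trace of an interface loop is at least `√2/4`
(mesh `1`, unrotated). (DKKMO 2020, §1.1.) [cite: arXiv201211672, §1.1] -/
theorem IsInterfaceLoop.le_infDist_faceCenter {ω : BondConfig (Site 2)} {γ : List MedialVertex}
    (h : IsInterfaceLoop ω γ) (g : Site 2) :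
    Real.sqrt 2 / 4 ≤ Metric.infDist (faceCenter g) (loopCurve 1 0 γ).range := by
  refine (Metric.le_infDist (RandomPlanarGeometry.CurveClass.range_nonempty _)).2 fun x hx ↦ ?_
  rw [dist_comm]
  exact h.sqrt_two_div_four_le_dist_faceCenter hx g

end Literature.Probability.Percolation

end
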